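import Summits.BirchSwinnertonDyer.BirchSwinnertonDyer.Theorems.ByReductionTypeAtTwoOrdKatoHalfAtTwoIsoSteinbergSahTwist
import Literature.NumberTheory.GaloisRepresentations.CyclotomicLevels
import HarnessLib

/-!
# Route ByReductionTypeAtTwo, crux `OrdKatoHalfAtTwoIso` (stmt-BirchSwinnertonDyer-19573), line `steinberg-fibre-at-two`
# (skeleton v11), stub `stub_coreA_posDisc : CoreTheoremAPosDiscTwo` (child 23967) — plan item (P3a): Steinberg–Sah on `𝒯_J(E)`
# relative to the DEEPER subgroup `ker ρ̄₂ ⊓ ker κ ⊓ Gal(ℚ̄/ℚ(μ_m))`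

Seat `cruxlead-stmt-BirchSwinnertonDyer-19573-g5` (LEAD PROVER, MODE LINE; HOME `run/shared/lean/pub/bsd-2adic/`; `--supports`
stmt-BirchSwinnertonDyer-19573 as helper). THEOREMS ONLY; nothing asserted; BSD is not proved by any of this; the crux and the stub are
NOT proved here.

WHY. The sign-free Chebotarev step H-C⁺ of the brief (P3) must produce Kolyvagin primes `q ≡ 1 (mod 4)`, i.e. Frobenii inside
`R4 = rootsOfUnityFixer ℚ 4`; running p681540's §2 with the groups `G ⊓ R4 ⊇ N ⊓ R4` needs the non-vanishing witnesses of the bottom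
cocycles inside `ker ρ̄₂ ⊓ ker κ ⊓ R4`, hence the Steinberg–Sah lemma with that DEEPER vanishing subgroup. Verbatim the proof of
`modPTwist_two_oneCocycleClass_eq_of_forall_mem_eq_of_noFixedPoint` (…SteinbergSahTwist, p657099-era; engine `SahRelNormal`) with
`N = ker ρ̄₂ ⊓ ker κ ⊓ Gal(ℚ̄/ℚ(μ_m))`: the one new point is that the commutator `(hσ₀)⁻¹(σ₀h) = [σ₀⁻¹, h⁻¹]` also fixes `μ_m`
(its mod-`m` cyclotomic character is trivial: `(ℤ/m)ˣ` is commutative). Injectivity, vanishing and dual-twist forms.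

References: C.-H. Sah, *J. Algebra* (1968) Prop. 2.7 (b) [Sah1968]; J.-P. Serre, Invent. Math. 15 (1972) §2.6 [Serre1972]; tree
`…SteinbergSahTwist.lean` (parent proof), `…SahRelNormal.lean` (engine), `CyclotomicLevels.lean` (`commutator_le_rootsOfUnityFixer`).
-/

set_option linter.dupNamespace false

noncomputable section

open Field WeierstrassCurve Function
open Literature.NumberTheory.EllipticCurves Literature.NumberTheory.GaloisRepresentations
open Literature.NumberTheory.EllipticCurves.DokchitserDokchitser2012
open Summit.BirchSwinnertonDyer.BirchSwinnertonDyer.Rank1Residual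

namespace Summit.BirchSwinnertonDyer.BirchSwinnertonDyer.Theorems.SteinbergFibreAtTwo

section SahDeeper

variable (W : WeierstrassCurve ℚ) [W.IsElliptic] (κ : ZpExtension ℚ 2)

/-- **Steinberg–Sah on `𝒯_J(E)` at `p = 2`, injectivity form, DEEPER vanishing subgroup `ker ρ̄₂ ⊓ ker κ ⊓ Gal(ℚ̄/ℚ(μ_m))`.** Let
`σ₀ ∈ ker κ` act on `E[2]` without non-zero fixed point. Two continuous 1-cocycles of `Γ_ℚ` in `𝒯_J(E) = W.modPTwist 2 κ J` that agree
on `ker ρ̄_{E,2} ⊓ ker κ ⊓ rootsOfUnityFixer ℚ m` have the same class (engine `SahRelNormal`, `H = ker(sgn ∘ permGal)`, `z = σ₀`; the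
centrality witness `(hσ₀)⁻¹(σ₀h)` is a commutator, hence fixes `μ_m`). [cite: Sah1968, Prop. 2.7 (b) and its proof, p. 60] [cite: Serre1972, §2.6] -/
theorem modPTwist_two_oneCocycleClass_eq_of_forall_mem_inf_rootsOfUnityFixer_eq_of_noFixedPoint
    (m : ℕ) [NeZero m] {σ₀ : absoluteGaloisGroup ℚ}
    (hκ : σ₀ ∈ κ.kerSubgroup) (hσ₀ : ∀ P : geomTorsion W 2, P ≠ 0 → σ₀ • P ≠ P) (J : ℕ)
    (φ ψ : contOneCocycles (W.modPTwist 2 κ J).toTopRep)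
    (hN : ∀ ν ∈ (galoisRepTorsion W 2).ker ⊓ κ.kerSubgroup ⊓ rootsOfUnityFixer ℚ m, φ.1 ν = ψ.1 ν) :
    oneCocycleClass _ φ = oneCocycleClass _ ψ := by
  have h2 : (2 : ℚ) ≠ 0 := two_ne_zero
  -- the permutation representation on `{T₀, T₁, T₂}` as a homomorphism, and `H = ker (sgn ∘ permGal)`
  let πG : absoluteGaloisGroup ℚ →* Equiv.Perm (Fin 3) :=
    { toFun := permGal W h2, map_one' := permGal_one W h2, map_mul' := permGal_mul W h2 }
  let H : Subgroup (absoluteGaloisGroup ℚ) := (Equiv.Perm.sign.comp πG).ker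
  have hHmem : ∀ g, g ∈ H ↔ Equiv.Perm.sign (permGal W h2 g) = 1 := fun g => by
    change (Equiv.Perm.sign.comp πG) g = 1 ↔ _
    rfl
  have hHnormal : H.Normal := MonoidHom.normal_ker _
  -- `σ₀` is a 3-cycle: even
  have hσ₀T : ∀ i, permGal W h2 σ₀ i ≠ i := by
    intro i hi
    have hT : σ₀ • T W h2 i = T W h2 i := by rw [← T_permGal, hi]
    exact hσ₀ (T W h2 i) (fun h0 => coe_T_ne_zero W h2 i (by rw [h0]; rfl)) hT
  have hσ₀H : σ₀ ∈ H := (hHmem σ₀).mpr (perm_fin_three_sign_eq_one_of_forall_ne _ hσ₀T)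
  -- `N ≤ H`
  have hNH : (galoisRepTorsion W 2).ker ⊓ κ.kerSubgroup ⊓ rootsOfUnityFixer ℚ m ≤ H := by
    intro ν hν
    have hν1 : permGal W h2 ν = 1 :=
      (forall_smul_eq_iff_permGal_eq_one W ν).mp
        ((mem_ker_galoisRepTorsion_two_iff W ν).mp (Subgroup.mem_inf.mp (Subgroup.mem_inf.mp hν).1).1)
    rw [hHmem, hν1, map_one]
  -- `σ₀` and `h ∈ H` commute on `E[2]`
  have hcommE : ∀ h ∈ H, ∀ P : geomTorsion W 2, σ₀ • h • P = h • σ₀ • P := by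
    intro h hh P
    have hperm : permGal W h2 (σ₀ * h) = permGal W h2 (h * σ₀) := by
      rw [permGal_mul, permGal_mul]
      exact perm_fin_three_comm_of_sign_eq_one _ _ ((hHmem σ₀).mp hσ₀H) ((hHmem h).mp hh)
    rw [← mul_smul, ← mul_smul]
    exact smul_eq_smul_of_permGal_eq W hperm P
  -- centrality of `σ₀` inside `H` modulo `N`
  have hz : ∀ h ∈ H, ∃ n ∈ (galoisRepTorsion W 2).ker ⊓ κ.kerSubgroup ⊓ rootsOfUnityFixer ℚ m, σ₀ * h = h * σ₀ * n := by
    intro h hh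
    refine ⟨(h * σ₀)⁻¹ * (σ₀ * h), Subgroup.mem_inf.mpr ⟨Subgroup.mem_inf.mpr ⟨?_, ?_⟩, ?_⟩, by group⟩
    · rw [mem_ker_galoisRepTorsion_two_iff]
      intro P
      rw [mul_smul, mul_smul, hcommE h hh P, ← mul_smul h σ₀, inv_smul_smul]
    · rw [ZpExtension.mem_kerSubgroup] at hκ ⊢
      rw [map_mul, map_inv, map_mul, map_mul, hκ, mul_one, one_mul, inv_mul_cancel]
    · -- a commutator fixes `μ_m`: the mod-`m` cyclotomic character is valued in a commutative group
      haveI : NeZero (m : ℚ) := NeZero.charZero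
      rw [rootsOfUnityFixer_eq_ker, MonoidHom.mem_ker, map_mul, map_inv, map_mul, map_mul,
        mul_comm (modNCyclotomicCharacter ℚ m σ₀) (modNCyclotomicCharacter ℚ m h), inv_mul_cancel]
  -- `ρ_𝒯(σ₀)` is coordinatewise `σ₀`
  have hρσ₀ : ∀ x : (W.modPTwist 2 κ J).toTopRep,
      (W.modPTwist 2 κ J).toTopRep.ρ σ₀ x = fun i => σ₀ • x i :=
    fun x => modPTwist_apply_of_mem_kerSubgroup W 2 κ J hκ x
  -- `ρ_𝒯(σ₀)` commutes with `ρ_𝒯(h)`, `h ∈ H`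
  let f : geomTorsion W ((2 : ℕ) : ℤ) →ₗ[ℤ] geomTorsion W ((2 : ℕ) : ℤ) :=
    (DistribSMul.toAddMonoidHom (geomTorsion W ((2 : ℕ) : ℤ)) σ₀).toIntLinearMap
  have hf : ∀ y : Fin J → geomTorsion W ((2 : ℕ) : ℤ), f.compLeft (Fin J) y = fun i => σ₀ • y i :=
    fun _ => rfl
  have hcomm : ∀ h ∈ H, ∀ x : (W.modPTwist 2 κ J).toTopRep,
      (W.modPTwist 2 κ J).toTopRep.ρ σ₀ ((W.modPTwist 2 κ J).toTopRep.ρ h x) =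
        (W.modPTwist 2 κ J).toTopRep.ρ h ((W.modPTwist 2 κ J).toTopRep.ρ σ₀ x) := by
    intro h hh x
    rw [hρσ₀, hρσ₀]
    change (fun i => σ₀ • (W.modPTwist 2 κ J h x) i) = W.modPTwist 2 κ J h (fun i => σ₀ • x i)
    rw [WeierstrassCurve.modPTwist_apply, WeierstrassCurve.modPTwist_apply, ← hf,
      ← Module.End.mul_apply, ← ZpExtension.unipotentPow_mul_compLeft, Module.End.mul_apply, hf]
    congr 1
    funext i
    exact hcommE h hh (x i)
  -- `ρ_𝒯(σ₀) − 1` is bijective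
  haveI : Finite (geomTorsion W (2 : ℤ)) :=
    WeierstrassCurve.finite_torsionPoints_holds W (AlgebraicClosure ℚ) (by norm_num)
  have hbij : Bijective fun x : (W.modPTwist 2 κ J).toTopRep => (W.modPTwist 2 κ J).toTopRep.ρ σ₀ x - x := by
    have hinj : Injective fun x : (W.modPTwist 2 κ J).toTopRep =>
        (W.modPTwist 2 κ J).toTopRep.ρ σ₀ x - x := by
      intro x y hxy
      have hxy' : ∀ i, σ₀ • (x i - y i) = x i - y i := by
        intro i
        have := congrFun (show (fun i => σ₀ • x i) - x = (fun i => σ₀ • y i) - y by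
          simpa only [hρσ₀] using hxy) i
        simp only [Pi.sub_apply] at this
        rw [smul_sub]
        -- σ₀ x i - x i = σ₀ y i - y i  ⇒  σ₀ x i - σ₀ y i = x i - y i
        have := sub_eq_sub_iff_sub_eq_sub.mp this
        exact this
      funext i
      by_contra hne
      exact hσ₀ (x i - y i) (sub_ne_zero.mpr hne) (hxy' i)
    exact ⟨hinj, Finite.injective_iff_surjective.mp hinj⟩
  exact SahRelNormal.oneCocycleClass_eq_of_forall_mem_eq_of_normal φ ψ _ H hHnormal hNH hN hσ₀H hz hcomm hbij

/-- **Vanishing form, deeper subgroup**: a cocycle of `𝒯_J(E)` vanishing on `ker ρ̄₂ ⊓ ker κ ⊓ Gal(ℚ̄/ℚ(μ_m))` has zero class.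
[cite: Sah1968, Prop. 2.7 (b) and its proof, p. 60] [cite: Serre1972, §2.6] -/
theorem modPTwist_two_oneCocycleClass_eq_zero_of_forall_mem_inf_rootsOfUnityFixer_eq_zero_of_noFixedPoint
    (m : ℕ) [NeZero m] {σ₀ : absoluteGaloisGroup ℚ} (hκ : σ₀ ∈ κ.kerSubgroup)
    (hσ₀ : ∀ P : geomTorsion W 2, P ≠ 0 → σ₀ • P ≠ P) (J : ℕ)
    (φ : contOneCocycles (W.modPTwist 2 κ J).toTopRep)
    (hN : ∀ ν ∈ (galoisRepTorsion W 2).ker ⊓ κ.kerSubgroup ⊓ rootsOfUnityFixer ℚ m, φ.1 ν = 0) :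
    oneCocycleClass _ φ = 0 := by
  rw [← oneCocycleClass_zero (W.modPTwist 2 κ J).toTopRep]
  exact modPTwist_two_oneCocycleClass_eq_of_forall_mem_inf_rootsOfUnityFixer_eq_of_noFixedPoint W κ m hκ hσ₀ J φ 0
    (fun ν hν => by rw [hN ν hν]; rfl)

/-- **Dual-twist form, deeper subgroup** (`𝒯_J(E)(χ⁻¹)`; `ker κ⁻¹ = ker κ`). [cite: Sah1968, Prop. 2.7 (b) and its proof, p. 60] -/
theorem invTwist_modPTwist_two_oneCocycleClass_eq_of_forall_mem_inf_rootsOfUnityFixer_eq_of_noFixedPoint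
    (m : ℕ) [NeZero m] {σ₀ : absoluteGaloisGroup ℚ} (hκ : σ₀ ∈ κ.kerSubgroup)
    (hσ₀ : ∀ P : geomTorsion W 2, P ≠ 0 → σ₀ • P ≠ P) (J : ℕ)
    (φ ψ : contOneCocycles (W.modPTwist 2 κ.invTwist J).toTopRep)
    (hN : ∀ ν ∈ (galoisRepTorsion W 2).ker ⊓ κ.kerSubgroup ⊓ rootsOfUnityFixer ℚ m, φ.1 ν = ψ.1 ν) :
    oneCocycleClass _ φ = oneCocycleClass _ ψ := by
  have hκ' : σ₀ ∈ κ.invTwist.kerSubgroup := by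
    rw [ZpExtension.kerSubgroup_unitTwist]
    exact hκ
  refine modPTwist_two_oneCocycleClass_eq_of_forall_mem_inf_rootsOfUnityFixer_eq_of_noFixedPoint W κ.invTwist m hκ' hσ₀ J
    φ ψ ?_
  rw [ZpExtension.kerSubgroup_unitTwist]
  exact hN

end SahDeeper

end Summit.BirchSwinnertonDyer.BirchSwinnertonDyer.Theorems.SteinbergFibreAtTwo

end
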